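import Summits.CriticalPhenomena.PercolationContinuityZ3.Theorems.PercNearOneGluingNoHeavyLowerTailSunflowerAndrasfaiCyclic
import Summits.CriticalPhenomena.PercolationContinuityZ3.Theorems.PercNearOneGluingNoHeavyLowerTailSunflowerSafePartition
import HarnessLib

/-!
# `NoHeavyLowerTail` (crux stmt-CriticalPhenomena-4575), abstract sunflower cubic: the ANDRÁSFAI GRAPHS ARE A-SAFE, part 1b —
# the co-arc transversal family, the functional `Λ`, and the reduction of safety to a colouring inequality

Support file (seat `prim-ineq-prove-1` gen 42; `--supports stmt-CriticalPhenomena-4575`).  No `sorry`, no named facts, standard axioms.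
Memo: run/shared/lean/prim/prim-ineq-prove-1/FINDING-BLOWUP-prove1-g42.md §7.

THIS FILE (continuing `…SunflowerAndrasfaiCyclic`).  The transversal family `coarcs k` (complements of the arcs) satisfies the
hypotheses of `SafeCalc.safe_of_disjoint_famIn` (`coarcs_bad`, `coarcs_cover`); the hitting functional of a set `C` of arc-starts is
`Λ p C = lam p C = Σ_ω w_p(ω)·[every arc containing ω starts in C]` (`famIn_coarcs_eq_lam`; `lam_mono`); and
**`safe_arcGraph_of_colouring_ineq`**: if `∏_j Λ p (c⁻¹ j) ≤ Λ p ∅ ^ (K-1)` for every `K ≥ 1` and every colouring `c` of the starts by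
`Fin K`, then `Safe p (edgeCore (arcGraph k))`.  Parts 2–4 prove that colouring inequality.
-/

noncomputable section

namespace Summit.CriticalPhenomena.PercolationContinuityZ3.Theorems.SunflowerPartition

namespace SafeCalc

open Finset MeasureTheory
open Literature.Probability.LatticeModels Literature.Probability.Percolation
open TwoGenCore (wmiss)

namespace Arc

variable {k : ℕ}

/-! ## The transversal family (complements of the arcs) and the polarisation hypotheses -/

/-- Distinct starts give distinct arcs (the start is the unique point of the arc whose predecessor is outside… we use: `t` is the
only point `x` of `arc k t` with `fd x y ≤ k` for all `y ∈ arc k t`… simpler: `fd t t' ≤ k` and `fd t' t ≤ k` force `t = t'`). -/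
theorem arc_injective : Function.Injective (arc k) := by
  intro t t' h
  have h1 : t' ∈ arc k t := by rw [h]; exact self_mem_arc t'
  have h2 : t ∈ arc k t' := by rw [← h]; exact self_mem_arc t
  rw [mem_arc] at h1 h2
  by_contra hne
  have := fd_add_fd_rev hne
  omega

/-- The family of complements of the arcs — the minimal transversals of the core. [this work] -/
def coarcs (k : ℕ) : Finset (Finset (Fin (3 * k + 2))) := univ.image fun t => (arc k t)ᶜ

/-- `t ↦ (arc k t)ᶜ` is injective. -/
theorem coarc_injective : Function.Injective fun t : Fin (3 * k + 2) => (arc k t)ᶜ :=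
  fun _ _ h => arc_injective (compl_injective h)

/-- The complement of a co-arc is an arc: not in the core. [this work] -/
theorem coarcs_bad : ∀ C ∈ coarcs k, ((univ \ C : Finset (Fin (3 * k + 2))) : Set (Fin (3 * k + 2))) ∉ edgeCore (arcGraph k) := by
  intro C hC
  obtain ⟨t, -, rfl⟩ := mem_image.1 hC
  rw [mem_edgeCore_arcGraph_iff, not_not]
  refine ⟨t, fun x hx => ?_⟩
  simpa using hx

/-- Every missing set whose complement is not in the core contains a co-arc. [this work] -/
theorem coarcs_cover : ∀ T : Finset (Fin (3 * k + 2)), T ⊆ univ →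
    ((univ \ T : Finset (Fin (3 * k + 2))) : Set (Fin (3 * k + 2))) ∉ edgeCore (arcGraph k) → ∃ C ∈ coarcs k, C ⊆ T := by
  intro T _ hT
  rw [mem_edgeCore_arcGraph_iff, not_not] at hT
  obtain ⟨t, ht⟩ := hT
  refine ⟨(arc k t)ᶜ, mem_image.2 ⟨t, mem_univ _, rfl⟩, fun x hx => ?_⟩
  rw [mem_compl] at hx
  by_contra hxT
  exact hx (ht (mem_sdiff.2 ⟨mem_univ _, hxT⟩))

/-- The core is determined by the whole vertex set (trivially). -/
theorem determinedBy_edgeCore_univ : DeterminedBy (edgeCore (arcGraph k)) (↑(univ : Finset (Fin (3 * k + 2))) : Set _) := by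
  rw [determinedBy_iff]
  intro ω ω' h
  rw [coe_univ, Set.inter_univ, Set.inter_univ] at h
  rw [h]

/-! ## The hitting functional of a set of starts -/

variable (p : Fin (3 * k + 2) → unitInterval)

/-- Weight of a row `ω` (probability that the open set is exactly `ω`). [this work] -/
def wrow (ω : Finset (Fin (3 * k + 2))) : ℝ := wmiss p univ ωᶜ

/-- `Λ p C`: total weight of the rows all of whose covering arcs start in `C` (rows in no arc included). [this work] -/
def lam (C : Finset (Fin (3 * k + 2))) : ℝ :=
  ∑ ω : Finset (Fin (3 * k + 2)), wrow p ω * (if ∀ t, ω ⊆ arc k t → t ∈ C then 1 else 0)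

/-- Row weights are nonnegative. -/
theorem wrow_nonneg (ω : Finset (Fin (3 * k + 2))) : 0 ≤ wrow p ω := wmiss_nonneg p _ _

/-- `Λ` is monotone in the set of starts. [this work] -/
theorem lam_mono {C D : Finset (Fin (3 * k + 2))} (h : C ⊆ D) : lam p C ≤ lam p D := by
  unfold lam
  refine sum_le_sum fun ω _ => mul_le_mul_of_nonneg_left ?_ (wrow_nonneg p ω)
  split_ifs with h1 h2
  · exact le_rfl
  · exact absurd (fun t ht => h (h1 t ht)) h2
  · norm_num
  · exact le_rfl

/-- `Λ` is nonnegative. -/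
theorem lam_nonneg (C : Finset (Fin (3 * k + 2))) : 0 ≤ lam p C :=
  sum_nonneg fun ω _ => mul_nonneg (wrow_nonneg p ω) (by split_ifs <;> norm_num)

/-- **The hitting functional of the co-arc family is `Λ`.**  For a set `C` of starts,
`famIn p univ (coarcs k) (C.image coarc) = Λ p C`. [this work] -/
theorem famIn_coarcs_eq_lam (C : Finset (Fin (3 * k + 2))) :
    famIn p univ (coarcs k) (C.image fun t => (arc k t)ᶜ) = lam p C := by
  classical
  unfold famIn BEx lam wrow
  rw [powerset_univ]
  -- reindex the sum over missing sets `T` by rows `ω = Tᶜ`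
  refine Fintype.sum_equiv (Equiv.mk (fun T => Tᶜ) (fun ω => ωᶜ) (fun T => compl_compl T) (fun ω => compl_compl ω)) _ _
    fun T => ?_
  simp only [Equiv.coe_fn_mk, compl_compl]
  congr 1
  have key : (∀ D ∈ coarcs k, D ⊆ T → D ∈ C.image fun t => (arc k t)ᶜ) ↔ ∀ t, Tᶜ ⊆ arc k t → t ∈ C := by
    constructor
    · intro h t ht
      have hsub : (arc k t)ᶜ ⊆ T := by
        intro x hx; rw [mem_compl] at hx; by_contra hxT; exact hx (ht (mem_compl.2 hxT))
      obtain ⟨t', ht', e⟩ := mem_image.1 (h _ (mem_image.2 ⟨t, mem_univ _, rfl⟩) hsub)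
      rwa [← coarc_injective e]
    · intro h D hD hDT
      obtain ⟨t, -, rfl⟩ := mem_image.1 hD
      refine mem_image.2 ⟨t, h t ?_, rfl⟩
      intro x hx; rw [mem_compl] at hx; by_contra hxa; exact hx (hDT (mem_compl.2 hxa))
  by_cases h : ∀ t, Tᶜ ⊆ arc k t → t ∈ C
  · rw [if_pos h, if_pos (key.2 h)]
  · rw [if_neg h, if_neg (fun h' => h (key.1 h'))]

/-- `Λ p ∅` is the hitting functional of the empty family (`= μ_p` of the core). -/
theorem famIn_coarcs_empty : famIn p univ (coarcs k) ∅ = lam p ∅ := by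
  have := famIn_coarcs_eq_lam (k := k) p ∅
  rwa [image_empty] at this

/-! ## Reduction of safety to the colouring inequality -/

/-- The class of colour `j`. -/
def cls {K : ℕ} (c : Fin (3 * k + 2) → Fin K) (j : Fin K) : Finset (Fin (3 * k + 2)) := univ.filter fun t => c t = j

/-- **Reduction.**  If `∏_j Λ p (c⁻¹ j) ≤ Λ p ∅ ^ (K - 1)` for every `K ≥ 1` and every colouring `c` of the starts by `Fin K`, then the
graph core of `arcGraph k` is safe for `p`.  (Polarisation `safe_of_disjoint_famIn` with the co-arc family; a tuple of pairwise
disjoint sub-families is dominated, by monotonicity of `Λ`, by the classes of a colouring.) [this work] -/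
theorem safe_arcGraph_of_colouring_ineq
    (H : ∀ (K : ℕ) (c : Fin (3 * k + 2) → Fin K), 0 < K → ∏ j, lam p (cls c j) ≤ lam p ∅ ^ (K - 1)) :
    Safe p (edgeCore (arcGraph k)) := by
  classical
  refine safe_of_disjoint_famIn p univ determinedBy_edgeCore_univ (isUpperSet_edgeCore _) (coarcs k)
    (fun C _ => subset_univ C) coarcs_bad coarcs_cover ?_
  intro K 𝒰 h𝒰 hdisj
  rcases Nat.eq_zero_or_pos K with rfl | hK
  · simp
  -- the sets of starts behind the sub-families
  set C : Fin K → Finset (Fin (3 * k + 2)) := fun i => univ.filter fun t => (arc k t)ᶜ ∈ 𝒰 i with hC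
  have hUC : ∀ i, 𝒰 i = (C i).image fun t => (arc k t)ᶜ := by
    intro i; ext D; constructor
    · intro hD
      obtain ⟨t, -, rfl⟩ := mem_image.1 (h𝒰 i hD)
      exact mem_image.2 ⟨t, by rw [hC, mem_filter]; exact ⟨mem_univ _, hD⟩, rfl⟩
    · intro hD
      obtain ⟨t, ht, rfl⟩ := mem_image.1 hD
      rw [hC, mem_filter] at ht; exact ht.2
  have hCdisj : ∀ i j, i ≠ j → Disjoint (C i) (C j) := by
    intro i j hij
    rw [Finset.disjoint_left]; intro t hti htj
    rw [hC, mem_filter] at hti htj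
    exact Finset.disjoint_left.1 (hdisj i j hij) hti.2 htj.2
  -- a colouring dominating the tuple: colour `t` by the unique `i` with `t ∈ C i`, else by `⟨0, hK⟩`
  let c : Fin (3 * k + 2) → Fin K := fun t => if h : ∃ i, t ∈ C i then h.choose else ⟨0, hK⟩
  have hsub : ∀ i, C i ⊆ cls c i := by
    intro i t ht
    rw [cls, mem_filter]
    refine ⟨mem_univ _, ?_⟩
    have hex : ∃ i, t ∈ C i := ⟨i, ht⟩
    show (if h : ∃ i, t ∈ C i then h.choose else ⟨0, hK⟩) = i
    rw [dif_pos hex]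
    by_contra hne
    exact Finset.disjoint_left.1 (hCdisj _ _ hne) hex.choose_spec ht
  calc ∏ i, famIn p univ (coarcs k) (𝒰 i) = ∏ i, lam p (C i) := by
        refine prod_congr rfl fun i _ => ?_
        rw [hUC i, famIn_coarcs_eq_lam]
    _ ≤ ∏ i, lam p (cls c i) :=
        prod_le_prod (fun i _ => lam_nonneg p _) fun i _ => lam_mono p (hsub i)
    _ ≤ lam p ∅ ^ (K - 1) := H K c hK
    _ = famIn p univ (coarcs k) ∅ ^ (K - 1) := by rw [famIn_coarcs_empty]

end Arc

end SafeCalc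

end Summit.CriticalPhenomena.PercolationContinuityZ3.Theorems.SunflowerPartition
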